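import Literature.Analysis.FluidPDE.SereginSverakBlowupCompactnessProofs
import Literature.Analysis.FluidPDE.LocalTypeIScaling
import HarnessLib

/-!
# Route HardyPointSink — `HardyAncientLimit`, step 7b: bookkeeping of the rescaled balls

Support file for item stmt-NavierStokesRegularity-9138 (`HardyAncientLimit`) of route
`HardyPointSink` (problem `NavierStokesRegularity`).

Elementary identities and inclusions used to transport scale-invariant bounds along the blow-up
`U_k(s, y) = c_k u₁(t_k + c_k² s, x_k + c_k y)` (Albritton–Barker 2019, §3: "it is clear from the
rescaling procedure that `u` will satisfy `𝐈 < ∞`"; the Hardy bound is likewise scale and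
translation invariant):

* `HardyAncientLimit.lintegral_hardy_zoom` — the Hardy functional is invariant:
  `∫_{B(y₁, R)} |c u(t, x₀ + c y)|² / |y − y₀| dy = ∫_{B(x₀ + c y₁, cR)} |u(t, x)|² / |x − (x₀ + c y₀)| dx`;
* `HardyAncientLimit.parabolicCylinder_subset_half_of_mem_parCyl`, `…_stAffine_subset_half` — a
  parabolic ball of radius `≤ 1/4` about a point of `Q(1/8)`, in particular the image
  `Q(Φ_k z, c_k r)` of a fixed ball `Q(z, r)`, `z.1 ≤ 0`, for `c_k` small, lies in `Q(0, 1/2)`;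
* `HardyAncientLimit.exists_parabolicCylinder_subset_parCyl` — a parabolic ball with vertex in
  `{s ≤ 0}` lies in some `Q(a) = 𝒞(a) × ]-a², 0[`;
* `HardyAncientLimit.scale_le_of_centre` — `c_k = 1/(2M_k) ≤ 1/(20(k+1))`.

## References

* D. Albritton, T. Barker, arXiv:1811.00502, §3.
* G. Seregin, V. Šverák, Comm. PDE 34 (2009) = arXiv:0804.1803, §4.
-/

noncomputable section

open Literature.Analysis.FluidPDE Literature.Analysis.FluidPDE.SereginSverak2009
open MeasureTheory Set Function Filter Topology Metric TopologicalSpace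
open scoped ENNReal NNReal

namespace Summit.NavierStokesRegularity.NavierStokesRegularity.Theorems

namespace HardyAncientLimit

/-! ### The Hardy functional under the Navier–Stokes zoom -/

/-- Pointwise form of the zoomed Hardy integrand: for `c > 0`,
`‖c v(x)‖² / ‖c⁻¹(x − x₁)‖ = c³ (‖v(x)‖² / ‖x − x₁‖)` in `ℝ≥0∞`. [folklore] -/
theorem hardy_integrand_zoom {c : ℝ} (hc : 0 < c) (v : EuclideanSpace ℝ (Fin 3) → EuclideanSpace ℝ (Fin 3))
    (x x₁ : EuclideanSpace ℝ (Fin 3)) :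
    ‖c • v x‖ₑ ^ 2 / ‖c⁻¹ • (x - x₁)‖ₑ = ENNReal.ofReal (c ^ 3) * (‖v x‖ₑ ^ 2 / ‖x - x₁‖ₑ) := by
  have hce : ‖c‖ₑ = ENNReal.ofReal c := Real.enorm_eq_ofReal hc.le
  have hcie : ‖c⁻¹‖ₑ = (ENNReal.ofReal c)⁻¹ := by
    rw [Real.enorm_eq_ofReal (inv_nonneg.2 hc.le), ENNReal.ofReal_inv_of_pos hc]
  have hc0 : ENNReal.ofReal c ≠ 0 := by simpa using hc
  have hct : ENNReal.ofReal c ≠ ⊤ := ENNReal.ofReal_ne_top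
  rw [enorm_smul, enorm_smul, hce, hcie, mul_pow, div_eq_mul_inv, div_eq_mul_inv,
    ENNReal.mul_inv (Or.inl (ENNReal.inv_ne_zero.2 hct)) (Or.inl (ENNReal.inv_ne_top.2 hc0)),
    inv_inv, show ENNReal.ofReal (c ^ 3) = ENNReal.ofReal c ^ 2 * ENNReal.ofReal c by
      rw [← ENNReal.ofReal_pow hc.le, ← ENNReal.ofReal_mul (by positivity)]; ring_nf]
  ring

/-- **Invariance of the Hardy functional under the Navier–Stokes zoom.** For `c > 0` and the
rescaled field `(s, y) ↦ c u(t₀ + c² s, x₀ + c y)`: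
`∫_{B(y₁, R)} ‖c u(t, x₀ + c y)‖² / ‖y − y₀‖ dy = ∫_{B(x₀ + c y₁, c R)} ‖u(t, x)‖² / ‖x − (x₀ + c y₀)‖ dx`,
`t = t₀ + c² s` (space substitution `x = x₀ + c y`, `dy = c⁻³ dx`). [folklore] -/
theorem lintegral_hardy_zoom {c : ℝ} (hc : 0 < c) (t₀ : ℝ) (x₀ : EuclideanSpace ℝ (Fin 3))
    (u : ℝ → EuclideanSpace ℝ (Fin 3) → EuclideanSpace ℝ (Fin 3)) (s : ℝ)
    (y₀ y₁ : EuclideanSpace ℝ (Fin 3)) (R : ℝ) :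
    ∫⁻ y in ball y₁ R, ‖(c • stPull (c ^ 2) c t₀ x₀ u) s y‖ₑ ^ 2 / ‖y - y₀‖ₑ =
      ∫⁻ x in ball (x₀ + c • y₁) (c * R),
        ‖u (t₀ + c ^ 2 * s) x‖ₑ ^ 2 / ‖x - (x₀ + c • y₀)‖ₑ := by
  set t : ℝ := t₀ + c ^ 2 * s with ht
  set x₁ : EuclideanSpace ℝ (Fin 3) := x₀ + c • y₀ with hx₁
  -- the integrand as a function of `x = x₀ + c y`
  set G : EuclideanSpace ℝ (Fin 3) → ℝ≥0∞ := fun x => ‖c • u t x‖ₑ ^ 2 / ‖c⁻¹ • (x - x₁)‖ₑ with hG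
  have hint : ∀ y, ‖(c • stPull (c ^ 2) c t₀ x₀ u) s y‖ₑ ^ 2 / ‖y - y₀‖ₑ = G (x₀ + c • y) := by
    intro y
    have e : c⁻¹ • (x₀ + c • y - x₁) = y - y₀ := by
      rw [hx₁, show x₀ + c • y - (x₀ + c • y₀) = c • (y - y₀) by rw [smul_sub]; abel,
        smul_smul, inv_mul_cancel₀ hc.ne', one_smul]
    simp only [hG, smul_stPull_apply, e, ht]
  simp_rw [hint]
  rw [← space_affine_preimage_ball_zoom hc x₀ y₁ R,
    setLIntegral_preimage_comp_space_affine hc x₀ G (ball (x₀ + c • y₁) (c * R)),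
    finrank_euclideanSpace_fin]
  have hG' : ∀ x, G x = ENNReal.ofReal (c ^ 3) * (‖u t x‖ₑ ^ 2 / ‖x - x₁‖ₑ) := fun x =>
    hardy_integrand_zoom hc (u t) x x₁
  simp_rw [hG']
  rw [lintegral_const_mul' _ _ ENNReal.ofReal_ne_top, ← mul_assoc, ← ENNReal.ofReal_mul (by positivity),
    inv_mul_cancel₀ (by positivity), ENNReal.ofReal_one, one_mul]

/-! ### Where the rescaled balls live -/

/-- A parabolic ball of radius `ρ ≤ 1/4` whose vertex lies in `Q(1/8) = 𝒞(1/8) × ]-1/64, 0[` is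
contained in the parabolic ball `Q(0, 1/2)`. [folklore] -/
theorem parabolicCylinder_subset_half_of_mem_parCyl {zk : ℝ × EuclideanSpace ℝ (Fin 3)}
    (hzk : zk ∈ parCyl (0 : ℝ × EuclideanSpace ℝ (Fin 3)) (1 / 8)) {ρ : ℝ} (hρ : 0 < ρ)
    (hρ4 : ρ ≤ 1 / 4) :
    parabolicCylinder ρ zk ⊆ parabolicCylinder (1 / 2) (0 : ℝ × EuclideanSpace ℝ (Fin 3)) := by
  rw [mem_parCyl_zero] at hzk
  obtain ⟨⟨ht1, ht2⟩, hr, ha⟩ := hzk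
  have hx : ‖zk.2‖ < 1 / 4 := by
    have h := norm_le_cylRadius_add_abs zk.2
    linarith
  intro z hz
  rw [mem_parabolicCylinder] at hz ⊢
  obtain ⟨⟨hz1, hz2⟩, hzx⟩ := hz
  simp only [Prod.fst_zero, Prod.snd_zero, dist_zero_right]
  refine ⟨⟨by nlinarith, hz2.trans ht2⟩, ?_⟩
  calc ‖z.2‖ = dist z.2 0 := (dist_zero_right _).symm
    _ ≤ dist z.2 zk.2 + dist zk.2 0 := dist_triangle _ _ _
    _ < ρ + 1 / 4 := by rw [dist_zero_right]; exact add_lt_add hzx hx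
    _ ≤ 1 / 2 := by linarith

/-- **The image of a fixed ball under the `k`-th zoom lies in `Q(0, 1/2)` for small scales.** For
`z.1 ≤ 0`, `r > 0`, a centre `z_k ∈ Q(1/8)` and a scale `0 < c ≤ 1` with
`c (|z.1| + r² + ‖z.2‖ + r) ≤ 1/8`: `Q(Φ z, c r) ⊆ Q(0, 1/2)`, `Φ(s, y) = (t_k + c² s, x_k + c y)`.
[folklore] -/
theorem parabolicCylinder_stAffine_subset_half {zk z : ℝ × EuclideanSpace ℝ (Fin 3)}
    (hzk : zk ∈ parCyl (0 : ℝ × EuclideanSpace ℝ (Fin 3)) (1 / 8)) (hz : z.1 ≤ 0) {r c : ℝ}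
    (hr : 0 < r) (hc : 0 < c) (hc1 : c ≤ 1)
    (hsmall : c * (|z.1| + r ^ 2 + ‖z.2‖ + r) ≤ 1 / 8) :
    parabolicCylinder (c * r) (stAffine (c ^ 2) c zk.1 zk.2 z) ⊆
      parabolicCylinder (1 / 2) (0 : ℝ × EuclideanSpace ℝ (Fin 3)) := by
  rw [mem_parCyl_zero] at hzk
  obtain ⟨⟨ht1, ht2⟩, hrad, hax⟩ := hzk
  have hx : ‖zk.2‖ < 1 / 4 := by
    have h := norm_le_cylRadius_add_abs zk.2
    linarith
  have hc2 : c ^ 2 ≤ c := by nlinarith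
  have habs : 0 ≤ |z.1| := abs_nonneg _
  have hn : 0 ≤ ‖z.2‖ := norm_nonneg _
  have h1 : c ^ 2 * (|z.1| + r ^ 2) ≤ 1 / 8 := by nlinarith
  have h2 : c * (‖z.2‖ + r) ≤ 1 / 8 := by nlinarith
  intro w hw
  rw [mem_parabolicCylinder] at hw ⊢
  simp only [stAffine_fst, stAffine_snd] at hw
  obtain ⟨⟨hw1, hw2⟩, hwx⟩ := hw
  simp only [Prod.fst_zero, Prod.snd_zero, dist_zero_right]
  have hz1 : -|z.1| ≤ z.1 := neg_abs_le _
  refine ⟨⟨?_, ?_⟩, ?_⟩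
  · -- lower time
    have e : (c * r) ^ 2 = c ^ 2 * r ^ 2 := by ring
    rw [e] at hw1
    nlinarith [mul_nonneg (sq_nonneg c) habs]
  · -- upper time
    have : c ^ 2 * z.1 ≤ 0 := mul_nonpos_of_nonneg_of_nonpos (sq_nonneg c) hz
    linarith
  · -- space
    calc ‖w.2‖ = dist w.2 0 := (dist_zero_right _).symm
      _ ≤ dist w.2 (zk.2 + c • z.2) + dist (zk.2 + c • z.2) 0 := dist_triangle _ _ _
      _ < c * r + (‖zk.2‖ + c * ‖z.2‖) := by
          refine add_lt_add_of_lt_of_le hwx ?_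
          rw [dist_zero_right]
          calc ‖zk.2 + c • z.2‖ ≤ ‖zk.2‖ + ‖c • z.2‖ := norm_add_le _ _
            _ = ‖zk.2‖ + c * ‖z.2‖ := by rw [norm_smul, Real.norm_eq_abs, abs_of_pos hc]
      _ ≤ 1 / 2 := by nlinarith

/-- A parabolic ball with vertex in the closed half-space `{s ≤ 0}` lies in some
`Q(a) = 𝒞(a) × ]-a², 0[` (and `a ≥ 1`). [folklore] -/
theorem exists_parabolicCylinder_subset_parCyl {z : ℝ × EuclideanSpace ℝ (Fin 3)} (hz : z.1 ≤ 0)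
    (r : ℝ) : ∃ a : ℝ, 1 ≤ a ∧ parabolicCylinder r z ⊆ parCyl 0 a := by
  set a : ℝ := |z.1| + r ^ 2 + ‖z.2‖ + |r| + 1 with ha
  have ha1 : 1 ≤ a := by
    rw [ha]; nlinarith [abs_nonneg z.1, sq_nonneg r, norm_nonneg z.2, abs_nonneg r]
  refine ⟨a, ha1, fun w hw => ?_⟩
  rw [mem_parabolicCylinder] at hw
  obtain ⟨⟨hw1, hw2⟩, hwx⟩ := hw
  have hz1 : -|z.1| ≤ z.1 := neg_abs_le _
  have haa : a ≤ a ^ 2 := by nlinarith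
  rw [mem_parCyl_zero]
  refine ⟨⟨by nlinarith [abs_nonneg z.1, norm_nonneg z.2, abs_nonneg r], hw2.trans_le hz⟩, ?_, ?_⟩
  · calc cylRadius w.2 ≤ ‖w.2‖ := cylRadius_le_norm' _
      _ ≤ dist w.2 z.2 + ‖z.2‖ := by
          have := norm_le_norm_add_norm_sub' w.2 z.2
          rw [dist_eq_norm]; linarith
      _ < a := by
          have : r ≤ |r| := le_abs_self r
          rw [ha]; nlinarith [abs_nonneg z.1, sq_nonneg r]
  · calc |w.2 2| ≤ ‖w.2‖ := by simpa only [Real.norm_eq_abs] using PiLp.norm_apply_le w.2 2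
      _ ≤ dist w.2 z.2 + ‖z.2‖ := by
          have := norm_le_norm_add_norm_sub' w.2 z.2
          rw [dist_eq_norm]; linarith
      _ < a := by
          have : r ≤ |r| := le_abs_self r
          rw [ha]; nlinarith [abs_nonneg z.1, sq_nonneg r]

/-- A parabolic ball with vertex in `{s ≤ 0}` lies in the half-closed cylinder
`𝒞(a) × ]-a², 0]` of the same `a`. [folklore] -/
theorem exists_parabolicCylinder_subset_parCylTop {z : ℝ × EuclideanSpace ℝ (Fin 3)} (hz : z.1 ≤ 0)
    (r : ℝ) : ∃ a : ℝ, 1 ≤ a ∧ parabolicCylinder r z ⊆ parCylTop a := by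
  obtain ⟨a, ha, h⟩ := exists_parabolicCylinder_subset_parCyl hz r
  exact ⟨a, ha, h.trans (parCyl_zero_subset_parCylTop a)⟩

/-! ### Smallness of the scales -/

/-- **The blow-up scales tend to zero quantitatively**: with `M = ‖v(z_k)‖`, `0 < d ≤ 1/10` and
`k + 1 ≤ M d`, the scale `c = 1/(2M)` satisfies `c ≤ 1 / (20 (k + 1))`. [folklore] -/
theorem scale_le_of_centre {M d : ℝ} {k : ℕ} (hd : 0 < d) (hd1 : d ≤ 1 / 10)
    (hN : (k : ℝ) + 1 ≤ M * d) : 1 / (2 * M) ≤ 1 / (20 * ((k : ℝ) + 1)) := by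
  have hk : (0 : ℝ) < (k : ℝ) + 1 := by positivity
  have hM : 0 < M := by
    by_contra h
    push Not at h
    have : M * d ≤ 0 := mul_nonpos_of_nonpos_of_nonneg h hd.le
    linarith
  have h1 : 10 * ((k : ℝ) + 1) ≤ M := by
    have h2 : ((k : ℝ) + 1) ≤ M * (1 / 10) := hN.trans (mul_le_mul_of_nonneg_left hd1 hM.le)
    linarith
  exact one_div_le_one_div_of_le (by positivity) (by linarith)

/-- Consequently, for every `L` and `ε > 0`, eventually `c_k L ≤ ε` along any sequence of scales
with `c_k ≤ 1/(20(k+1))`. [folklore] -/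
theorem eventually_scale_mul_le {c : ℕ → ℝ} (hc0 : ∀ k, 0 < c k)
    (hc : ∀ k : ℕ, c k ≤ 1 / (20 * ((k : ℝ) + 1))) (L : ℝ) {ε : ℝ} (hε : 0 < ε) :
    ∀ᶠ k in atTop, c k * L ≤ ε := by
  have ht : Tendsto (fun k : ℕ => 1 / (20 * ((k : ℝ) + 1))) atTop (𝓝 0) := by
    have h1 : Tendsto (fun k : ℕ => 20 * ((k : ℝ) + 1)) atTop atTop :=
      (tendsto_natCast_atTop_atTop.atTop_add tendsto_const_nhds).const_mul_atTop (by norm_num)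
    rw [show (fun k : ℕ => 1 / (20 * ((k : ℝ) + 1))) = fun k : ℕ => (20 * ((k : ℝ) + 1))⁻¹ from
      funext fun k => one_div _]
    exact h1.inv_tendsto_atTop
  have ht' : Tendsto (fun k => c k) atTop (𝓝 0) :=
    squeeze_zero (fun k => (hc0 k).le) hc ht
  have ht'' : Tendsto (fun k => c k * L) atTop (𝓝 (0 * L)) := ht'.mul_const L
  rw [zero_mul] at ht''
  exact (ht''.eventually (Iic_mem_nhds hε)).mono fun k hk => hk

end HardyAncientLimit

end Summit.NavierStokesRegularity.NavierStokesRegularity.Theorems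

end
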